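import Summits.BirchSwinnertonDyer.Rank1Residual.GaloisImage.TateModuleEulerFactor
import Summits.BirchSwinnertonDyer.Rank1Residual.GaloisImage.ComparisonOperatorLevelChange
import Literature.NumberTheory.GaloisCohomology.FiniteSingularComparison
import Literature.NumberTheory.EllipticCurves.TateModuleProofs
import Literature.NumberTheory.EllipticCurves.GaloisActionProofs
import HarnessLib

/-!
# THEOREM C's operator `Q̃(Fr⁻¹)` on `E[p^n]` IS Rubin's finite–singular comparison operator `Q(Fr⁻¹)`
# (`comparisonOp`) at a Kolyvagin prime, where `Q(x) = x − 1` — row T-DER, item C5b (i) (cell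
# `b2b-bsdres`, team n1011, seat p13 GEN 12; skeleton `cells/n1011/skel/T-DER.md` STATUS v9 (v9-3))

HONEST FRAMING (cell `b2b-bsdres`, run/shared/lean/b2b/bsd-rank1-residual/, verbatim in every
file): the goal of the cell is to DELETE the COMBINATION-SHAPED residual classes of the
Birch–Swinnerton-Dyer formula for ALL analytic-rank `≤ 1` elliptic curves over `ℚ` — "full BSD
formula for every rank `≤ 1` curve in class `C`" assembled STRICTLY from published theorems — so
that the rank-`≤ 1` remainder becomes exactly the CONSTRUCTION-SHAPED classes, which are TYPED
(missing-input `Prop`s), NOT attempted. This is not "finishing BSD". Team n1011: research route on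
the CONSTRUCTION-SHAPED class X4 / §I N11 (route-1 PORT, (P-DER)); TOOL theorems of linear algebra
on the Tate module — no Euler system is asserted, no definition, no named fact, no `sorry`; nothing
is booked; no mark / label / count moves.

## What, and where it plugs in
THEOREM C of row T-DER (`Derivative.Rat.apply_sigma_eq_aeval_apply_of_eulerSystem`, p11 E3/E4b)
concludes `Φ(τ) = aeval (ρ_{T′}(Fr⁻¹)) Q̃ (Φ_r(Fr))` for ANY `Q̃ ∈ ℤ_p[X]` with
`(X − 1)·Q̃ = 𝐏⟦Fr⟧ − 𝐏⟦Fr⟧(1)`, `𝐏⟦Fr⟧ = P(Fr⁻¹ | T_pE*; X) = 1 − q⁻¹a_q X + q⁻¹X²` (`rubinEulerFactor`;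
n1011-p13 K1).  The glue of the `fs_rel` clause of `IsKolyvaginSystem` (p11 C5a
`FS.singularLocalization_eq_fsLocalization_of_forall_apply_eq`) wants `Φ(τ) = ρ.comparisonOp N Fr (Φ_r(Fr))`
for the DISCRETE module `ρ = W.torsionGaloisModule m`, `N = p^n`: `comparisonOp N Fr = Q(Fr⁻¹)`,
`Q = P/(X − 1)`, `P(x) = det(1 − Fr x | E[p^n])` (Rubin PCMI Def. 1.9.6; tree `FiniteSingularComparison`).
Here: the two operators AGREE on `E[p^n]` at every Kolyvagin prime of level `n`
(`Kato.IsKolyvaginPrime W p n q`: `q ≡ 1`, `a_q ≡ q + 1 (mod p^n)`), for EVERY spelling `m = p^n` and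
EVERY `ℤ/p^n`-structure on `E[m]` (an instance BINDER; it is unique), and both are `Fr⁻¹ − 1` there
(Kim, AJM 2026, §2.3.2: "`P_ℓ(x) ≡ (x − 1)² mod I_ℓ`"):
* §1 `exists_basis_proj_eq` (a `ℤ_p`-basis of `T_pA` reducing to a `ℤ/p^n`-basis of `A[p^n]`: frames,
  `TateModule.levelMap_bijective`, `pairMap_bijective_of_levelMap_bijective`); §2
  `charpoly_zmodEnd_torsion_eq_map` (`charpoly(σ | E[p^n]) = charpoly(σ | T_pE) mod p^n`, any field, any
  `σ`; n1011-p15 `KSDevissage.charpoly_eq_map_of_semilinear` along `a ↦ a_n`); §3 at a good place over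
  `q ≠ p`: `charpoly(Fr | E[p^n]) = X² − a_qX + q`, `P = 1 − a_qX + qX²` in `(ℤ/p^n)[X]` (Silverman C.21.3,
  `trace/det_galoisRepTate_frobenius_of_hasGoodReductionAt_holds` via `charpoly_tateModule_eq`);
* §4 at a Kolyvagin prime of level `n`: `P = (X − 1)²`, `P(1) = 0` (the field `eval_one_comparisonP` of
  `IsFiniteSingularComparisonWith`, from print's congruences — no (H.2) shape), `Q = X − 1`,
  `Q(Fr⁻¹)x = Fr⁻¹x − x`; for THEOREM C's data `𝐏⟦Fr⟧ mod p^n = P` (K1) and `Q̃ mod p^n = Q` (monic division);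
* §5 **`map_aeval_eq_comparisonOp_of_isKolyvaginPrime`**: `g (aeval T Q̃ y) = comparisonOp (p^n) Fr (g y)`
  for any `ℤ_p`-module `M′` with endomorphism `T` mapped additively by `g` into `E[m]`, scalars acting
  through residues mod `p^n` and `T` as `Fr⁻¹` (case of record `M′ = E[p^n]_{ℤ_p}` =
  `TorsionCoeff.torsionRepPadicInt W p n`, n1011-p13 GZ-2, `T = ρ(Fr⁻¹)`, `g` the inclusion;
  n1011-p15 `KSDevissage.apply_aeval_eq_aeval_map`).
The two conventions (`𝐏` = Rubin's `det(1 − Fr⁻¹X | T*)` = Kato's `P_q(q⁻¹X)`; the comparison map's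
`P = det(1 − Fr x | E[p^n])`) differ by `q⁻¹` on the coefficients and coincide mod `p^n` exactly
when `q ≡ 1 (mod p^n)`.  0 defs, 0 facts, 0 sorry.  Not claimed: any (H.2) shape; the transport of
cocycle VALUES `E[p^n]_{ℤ_p} ↔ E[m]_ℤ` (C5b (ii), GZ-1 `CoeffTransport`).  References: K. Rubin, PCMI 18
(2011), Def. 1.9.6; B. Mazur, K. Rubin, Mem. AMS 799 (2004), Def. 1.2.2; K. Rubin, *Euler Systems*
(2000), Thm. 4.5.4; C.-H. Kim, AJM 148 (2026), §2.1.2, §2.3.2; J. H. Silverman, *AEC*, III.§7, C.21.3.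
-/

noncomputable section

open Polynomial Field IsDedekindDomain
open scoped NumberField AddSubgroup
open Literature.NumberTheory.GaloisRepresentations Literature.NumberTheory.EllipticCurves
open Literature.NumberTheory.GaloisRepresentations.DiscreteGaloisModule

namespace Summit.BirchSwinnertonDyer.Rank1Residual.GaloisImage.TorsionComparison

/-! ## §1 Frames: a pair `a, b ∈ T_p A` whose reductions generate every level -/

section Frame

open TateModule

/-- Any `ℤ/N`-module structure on an additive group acts through representatives. [folklore] -/
theorem zmod_smul_eq_val_smul {N : ℕ} [NeZero N] {M : Type*} [AddCommGroup M] [Module (ZMod N) M]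
    (c : ZMod N) (x : M) : c • x = c.val • x := by
  conv_lhs => rw [← ZMod.natCast_zmod_val c]
  exact Nat.cast_smul_eq_nsmul _ _ _

variable {A : Type*} [AddCommGroup A] {p : ℕ} [Fact p.Prime]

/-- **A `ℤ_p`-basis of `T_p A` reducing to a `ℤ/p^n`-basis of `A[p^n]`** (for EVERY `ℤ/p^n`-module
structure on `A[p^n]`), when `#A[p^k] = p^{2k}` for all `k` (e.g. `A = E(F̄)`): lift generators of `A[p]`
to `a, b ∈ T_p A` (`TateModule.exists_generators_of_card_torsionBy`, `exists_proj_one_eq`); all level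
maps `(x, y) ↦ x a_k + y b_k` are bijective (`levelMap_bijective`), hence so is `(x, y) ↦ x a + y b` on
`ℤ_p²` (`pairMap_bijective_of_levelMap_bijective`).  Silverman, *AEC*, III.7.1. [folklore] -/
theorem exists_basis_proj_eq (hc : ∀ k : ℕ, Nat.card (A[(p ^ k : ℕ)]) = p ^ (2 * k)) (n : ℕ)
    [Module (ZMod (p ^ n)) (A[(p ^ n : ℕ)])] :
    ∃ (b : Module.Basis (Fin 2) ℤ_[p] (TateModule A p))
      (b' : Module.Basis (Fin 2) (ZMod (p ^ n)) (A[(p ^ n : ℕ)])),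
      ∀ i, (proj p n).codRestrict (A[(p ^ n : ℕ)]) (proj_mem_torsionBy n) (b i) = b' i := by
  haveI : NeZero (p ^ n) := ⟨pow_ne_zero _ (Fact.out : p.Prime).ne_zero⟩
  obtain ⟨P₁, hP₁, Q₁, hQ₁, hgen₁⟩ :=
    exists_generators_of_card_torsionBy (A := A) (p := p) (by simpa using hc 1)
  have hs := exists_smul_eq_of_card_torsionBy (A := A) hc
  obtain ⟨a, ha⟩ := exists_proj_one_eq (A := A) (fun k P hP ↦ hs k hP) hP₁
  obtain ⟨b, hb⟩ := exists_proj_one_eq (A := A) (fun k P hP ↦ hs k hP) hQ₁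
  have hgen : ∀ R ∈ A[(p : ℕ)], ∃ m n : ℤ, m • proj p 1 a + n • proj p 1 b = R := by
    rw [ha, hb]; exact hgen₁
  have hlev : ∀ k, Function.Bijective (levelMap p a b k) := levelMap_bijective a b hc hgen
  have hpair : Function.Bijective (pairMap a b) := pairMap_bijective_of_levelMap_bijective a b hlev
  -- the `ℤ_p`-basis `(a, b)` of `T_p A`
  have hli : LinearIndependent ℤ_[p] ![a, b] := by
    refine LinearIndependent.pair_iff.2 fun s t hst => ?_
    have h0 : pairMap a b (s, t) = pairMap a b 0 := by rw [pairMap_apply, pairMap_apply]; simpa using hst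
    have h1 := hpair.1 h0
    exact ⟨congrArg Prod.fst h1, congrArg Prod.snd h1⟩
  have hsp : ⊤ ≤ Submodule.span ℤ_[p] (Set.range ![a, b]) := by
    intro t _
    obtain ⟨⟨x, y⟩, rfl⟩ := hpair.2 t
    rw [pairMap_apply]
    exact Submodule.add_mem _
      (Submodule.smul_mem _ _ (Submodule.subset_span ⟨0, rfl⟩))
      (Submodule.smul_mem _ _ (Submodule.subset_span ⟨1, rfl⟩))
  -- the `ℤ/p^n`-basis `(a_n, b_n)` of `A[p^n]`
  set a' : A[(p ^ n : ℕ)] := ⟨proj p n a, proj_mem_torsionBy n a⟩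
  set b'' : A[(p ^ n : ℕ)] := ⟨proj p n b, proj_mem_torsionBy n b⟩
  have hlev' : ∀ x y : ZMod (p ^ n), levelMap p a b n (x, y) = x • a' + y • b'' := by
    intro x y
    apply Subtype.ext
    rw [coe_levelMap, zmod_smul_eq_val_smul, zmod_smul_eq_val_smul, AddSubgroup.coe_add,
      AddSubmonoidClass.coe_nsmul, AddSubmonoidClass.coe_nsmul]
  have hli' : LinearIndependent (ZMod (p ^ n)) ![a', b''] := by
    refine LinearIndependent.pair_iff.2 fun s t hst => ?_
    have h0 : levelMap p a b n (s, t) = levelMap p a b n (0, 0) := by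
      rw [hlev', hlev', hst, zero_smul, zero_smul, add_zero]
    have h1 := (hlev n).1 h0
    exact ⟨congrArg Prod.fst h1, congrArg Prod.snd h1⟩
  have hsp' : ⊤ ≤ Submodule.span (ZMod (p ^ n)) (Set.range ![a', b'']) := by
    intro z _
    obtain ⟨⟨x, y⟩, hxy⟩ := (hlev n).2 z
    rw [← hxy, hlev']
    exact Submodule.add_mem _
      (Submodule.smul_mem _ _ (Submodule.subset_span ⟨0, rfl⟩))
      (Submodule.smul_mem _ _ (Submodule.subset_span ⟨1, rfl⟩))
  refine ⟨Module.Basis.mk hli hsp, Module.Basis.mk hli' hsp', fun i => ?_⟩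
  rw [Module.Basis.mk_apply, Module.Basis.mk_apply]
  fin_cases i <;> rfl

end Frame

/-! ## §2 The characteristic polynomial of `σ` on `E[p^n]` is that on `T_p E` reduced mod `p^n` -/

section Charpoly
open TateModule WeierstrassCurve
variable {F : Type} [Field F] (W : WeierstrassCurve F) [W.IsElliptic] (p : ℕ) [Fact p.Prime]

/-- **`charpoly(σ | E[p^n]) = charpoly(σ | T_pE) mod p^n`** for every `σ ∈ Γ_F`, every `n`, and
every `ℤ/p^n`-module structure on `E[p^n]` (free of finite rank): the reduction `a ↦ a_n` is additive,
`ℤ_p → ℤ/p^n`-semilinear, `Γ_F`-equivariant and carries a `ℤ_p`-basis to a `ℤ/p^n`-basis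
(`exists_basis_proj_eq`), so the matrices correspond (`KSDevissage.charpoly_eq_map_of_semilinear`).
Silverman, *AEC*, III.§7. [folklore] -/
theorem charpoly_zmodEnd_torsion_eq_map (hp : (p : F) ≠ 0) (n : ℕ)
    [Module (ZMod (p ^ n)) (geomTorsion W ((p ^ n : ℕ) : ℤ))]
    [Module.Free (ZMod (p ^ n)) (geomTorsion W ((p ^ n : ℕ) : ℤ))]
    [Module.Finite (ZMod (p ^ n)) (geomTorsion W ((p ^ n : ℕ) : ℤ))]
    [Module.Free ℤ_[p] (W.tateModule p)] [Module.Finite ℤ_[p] (W.tateModule p)]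
    (σ : absoluteGaloisGroup F) :
    ((W.torsionGaloisModule ((p ^ n : ℕ) : ℤ)).zmodEnd (p ^ n) σ).charpoly =
      (W.galoisRepTate p σ).charpoly.map (PadicInt.toZModPow n) := by
  classical
  haveI : NeZero (p ^ n) := ⟨pow_ne_zero _ (Fact.out : p.Prime).ne_zero⟩
  have hc : ∀ k : ℕ, Nat.card (geomTorsion W ((p ^ k : ℕ) : ℤ)) = p ^ (2 * k) :=
    card_geomTorsion_pow_eq W p (card_torsionPoints_eq_sq_holds W (AlgebraicClosure F)) hp
  obtain ⟨b, b', hbb'⟩ := exists_basis_proj_eq (A := geomPoints W) (p := p) hc n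
  refine KSDevissage.charpoly_eq_map_of_semilinear (PadicInt.toZModPow n) b b'
    ((proj p n).codRestrict (geomTorsion W ((p ^ n : ℕ) : ℤ)) (proj_mem_torsionBy n))
    (fun r a => ?_) hbb' _ _ (fun a => ?_)
  · apply Subtype.ext
    change proj p n (r • a) =
      (((PadicInt.toZModPow n r) •
        (proj p n).codRestrict (geomTorsion W ((p ^ n : ℕ) : ℤ)) (proj_mem_torsionBy n) a :
          geomTorsion W ((p ^ n : ℕ) : ℤ)) : geomPoints W)
    rw [zmod_smul_eq_val_smul, AddSubmonoidClass.coe_nsmul, proj_smul]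
    rfl
  · apply Subtype.ext
    change proj p n (σ • a) =
      (((W.torsionGaloisModule ((p ^ n : ℕ) : ℤ)).zmodEnd (p ^ n) σ
        ((proj p n).codRestrict (geomTorsion W ((p ^ n : ℕ) : ℤ)) (proj_mem_torsionBy n) a) :
          geomTorsion W ((p ^ n : ℕ) : ℤ)) : geomPoints W)
    rw [zmodEnd_apply, torsionGaloisModule_apply_apply, AddSubgroup.torsionBy.coe_smul]
    rfl

end Charpoly

/-! ## §3 `E/ℚ`: the Frobenius at a good prime `q ≠ p` on `E[p^n]` -/

section Frobenius
open TateModule WeierstrassCurve Rat.HeightOneSpectrum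
variable (W : WeierstrassCurve ℚ) [W.IsElliptic] [W.IsGloballyMinimal] (p : ℕ) [Fact p.Prime] (n : ℕ)
  [Module (ZMod (p ^ n)) (geomTorsion W ((p ^ n : ℕ) : ℤ))]
  [Module.Free (ZMod (p ^ n)) (geomTorsion W ((p ^ n : ℕ) : ℤ))]
  [Module.Finite (ZMod (p ^ n)) (geomTorsion W ((p ^ n : ℕ) : ℤ))]

/-- **`charpoly(Frob_q | E[p^n]) = X² − a_q X + q` in `(ℤ/p^n)[X]`** at a place `v` of good
reduction over a prime `q ≠ p`, for an arithmetic Frobenius `Fr` at `v` — the reduction mod `p^n`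
of Silverman C.21.3 on `T_pE` (`trace/det_galoisRepTate_frobenius_of_hasGoodReductionAt_holds`,
`charpoly_tateModule_eq`) along `charpoly_zmodEnd_torsion_eq_map`. [folklore] -/
theorem charpoly_zmodEnd_torsion_frobenius {v : HeightOneSpectrum (𝓞 ℚ)}
    (hne : ((primesEquiv v : Nat.Primes) : ℕ) ≠ p) (hv : W.HasGoodReductionAt v)
    {Fr : absoluteGaloisGroup ℚ} (hFr : IsArithFrobAtPlace ℚ v Fr) :
    ((W.torsionGaloisModule ((p ^ n : ℕ) : ℤ)).zmodEnd (p ^ n) Fr).charpoly =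
      X ^ 2 - C ((W.frobeniusTrace (primesEquiv v) : ℤ) : ZMod (p ^ n)) * X +
        C ((((primesEquiv v : Nat.Primes) : ℕ) : ℕ) : ZMod (p ^ n)) := by
  haveI := W.module_free_tateModule_holds p
  haveI := W.module_finite_tateModule_holds p
  have hpℚ : (p : ℚ) ≠ 0 := Nat.cast_ne_zero.mpr (Fact.out : p.Prime).ne_zero
  obtain ⟨𝔓, h𝔓, hσ⟩ := hFr
  have hpv : (p : 𝓞 ℚ) ∉ v.asIdeal :=
    WeierstrassCurve.natCast_not_mem_asIdeal_of_primesEquiv_ne Fact.out hne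
  have hchar : (W.galoisRepTate p Fr).charpoly =
      X ^ 2 - C (W.frobeniusTrace (primesEquiv v) : ℤ_[p]) * X +
        C ((((primesEquiv v : Nat.Primes) : ℕ) : ℕ) : ℤ_[p]) := by
    rw [WeierstrassCurve.charpoly_tateModule_eq hpℚ,
      W.trace_galoisRepTate_frobenius_eq_frobeniusTrace p hne hv h𝔓 hσ,
      W.det_galoisRepTate_frobenius_of_hasGoodReductionAt_holds p v hpv hv h𝔓 hσ,
      WeierstrassCurve.natCard_residueField_adicCompletionIntegers]
  rw [charpoly_zmodEnd_torsion_eq_map W p hpℚ n Fr, hchar, Polynomial.map_add, Polynomial.map_sub,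
    Polynomial.map_mul, Polynomial.map_pow, map_X, map_C, map_C, map_intCast, map_natCast]

/-- **Rubin's `P(x) = det(1 − Fr_q x | E[p^n]) = 1 − a_q x + q x²`** in `(ℤ/p^n)[x]` (the tree's
`comparisonP`, Rubin PCMI Def. 1.9.6 / Kim §2.1.2) at a place of good reduction over `q ≠ p`. [folklore] -/
theorem comparisonP_torsion_frobenius {v : HeightOneSpectrum (𝓞 ℚ)}
    (hne : ((primesEquiv v : Nat.Primes) : ℕ) ≠ p) (hv : W.HasGoodReductionAt v)
    {Fr : absoluteGaloisGroup ℚ} (hFr : IsArithFrobAtPlace ℚ v Fr) :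
    (W.torsionGaloisModule ((p ^ n : ℕ) : ℤ)).comparisonP (p ^ n) Fr =
      1 - C ((W.frobeniusTrace (primesEquiv v) : ℤ) : ZMod (p ^ n)) * X +
        C ((((primesEquiv v : Nat.Primes) : ℕ) : ℕ) : ZMod (p ^ n)) * X ^ 2 := by
  haveI : NeZero (p ^ n) := ⟨pow_ne_zero _ (Fact.out : p.Prime).ne_zero⟩
  by_cases h1 : p ^ n = 1
  · haveI : Subsingleton (ZMod (p ^ n)) := by rw [h1]; infer_instance
    exact Subsingleton.elim _ _
  haveI : Nontrivial (ZMod (p ^ n)) := ZMod.nontrivial_iff.mpr h1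
  rw [comparisonP_def, charpoly_zmodEnd_torsion_frobenius W p n hne hv hFr,
    Polynomial.reverse_X_sq_sub_C_mul_X_add_C]

end Frobenius

/-! ## §4 At a Kolyvagin prime of level `n`: `P(1) = 0`, `P = 𝐏⟦Fr⟧ mod p^n`, `Q = Q̃ mod p^n` -/

section Kolyvagin
open TateModule WeierstrassCurve Rat.HeightOneSpectrum
open Summit.BirchSwinnertonDyer.Rank1Residual.GaloisImage.CyclotomicLevel
/-- **`q ≡ 1 (mod p^n)` in `ℤ/p^n`** at a Kolyvagin prime of level `n`. [folklore] -/
theorem natCast_eq_one_of_isKolyvaginPrime (W : WeierstrassCurve ℚ) [W.IsGloballyMinimal] (p n : ℕ)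
    {q : HeightOneSpectrum (𝓞 ℚ)} (hKol : Kato.IsKolyvaginPrime W p n ((primesEquiv q : Nat.Primes) : ℕ)) :
    ((((primesEquiv q : Nat.Primes) : ℕ) : ℕ) : ZMod (p ^ n)) = 1 := by
  have h := (ZMod.natCast_eq_natCast_iff _ _ _).mpr hKol.modEq_one
  rwa [Nat.cast_one] at h

/-- **`a_q ≡ q + 1 ≡ 2 (mod p^n)` in `ℤ/p^n`** at a Kolyvagin prime of level `n`. [folklore] -/
theorem intCast_frobeniusTrace_eq_of_isKolyvaginPrime (W : WeierstrassCurve ℚ) [W.IsGloballyMinimal]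
    (p n : ℕ) {q : HeightOneSpectrum (𝓞 ℚ)} (hKol : Kato.IsKolyvaginPrime W p n ((primesEquiv q : Nat.Primes) : ℕ)) :
    ((W.frobeniusTrace (primesEquiv q) : ℤ) : ZMod (p ^ n)) =
      ((((primesEquiv q : Nat.Primes) : ℕ) : ℕ) : ZMod (p ^ n)) + 1 := by
  have h := (ZMod.intCast_eq_intCast_iff_dvd_sub
    ((((primesEquiv q : Nat.Primes) : ℕ) : ℤ) + 1) (W.frobeniusTrace (primesEquiv q)) (p ^ n)).mpr
    hKol.frobeniusTrace_modEq.symm.dvd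
  rw [← h]
  push_cast
  rfl

variable (W : WeierstrassCurve ℚ) [W.IsElliptic] [W.IsGloballyMinimal] (p : ℕ) [Fact p.Prime] (n : ℕ)
  [Module (ZMod (p ^ n)) (geomTorsion W ((p ^ n : ℕ) : ℤ))]
  [Module.Free (ZMod (p ^ n)) (geomTorsion W ((p ^ n : ℕ) : ℤ))]
  [Module.Finite (ZMod (p ^ n)) (geomTorsion W ((p ^ n : ℕ) : ℤ))]

/-- Local notation: `𝐏⟦φ⟧ = P(φ⁻¹ | T_pE^*; X)`, Rubin's Euler factor of the Tate module (THEOREM C's). -/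
local notation3 "𝐏⟦" φ "⟧" =>
  rubinEulerFactor (WeierstrassCurve.galoisRepTate W p) (cyclotomicCharacterToUnits ℚ p ℤ_[p]) φ

/-- **`P(x) = det(1 − Fr_q x | E[p^n]) = (x − 1)²`** at a Kolyvagin prime `q` of level `n` (`q ≡ 1`,
`a_q ≡ q + 1 (mod p^n)`; Kim, AJM 2026, §2.3.2: "`P_ℓ(x) ≡ (x − 1)² mod I_ℓ`").
[cite: Kim2022StructureSelmer, §2.3.2] -/
theorem comparisonP_torsion_eq_sq_of_isKolyvaginPrime {q : HeightOneSpectrum (𝓞 ℚ)}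
    (hKol : Kato.IsKolyvaginPrime W p n ((primesEquiv q : Nat.Primes) : ℕ))
    {Fr : absoluteGaloisGroup ℚ} (hFr : IsArithFrobAtPlace ℚ q Fr) :
    (W.torsionGaloisModule ((p ^ n : ℕ) : ℤ)).comparisonP (p ^ n) Fr = (X - C 1) ^ 2 := by
  rw [comparisonP_torsion_frobenius W p n hKol.ne (Rat.hasGoodReductionAt_of_isKolyvaginPrime W hKol)
    hFr, intCast_frobeniusTrace_eq_of_isKolyvaginPrime W p n hKol,
    natCast_eq_one_of_isKolyvaginPrime W p n hKol, C_add, C_1]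
  ring

/-- **`P(1) = 0`** on `E[p^n]` at a Kolyvagin prime of level `n`: the field `eval_one_comparisonP` of
`IsFiniteSingularComparisonWith`, from print's congruences rather than from an (H.2)-shape. [folklore] -/
theorem eval_one_comparisonP_torsion_eq_zero_of_isKolyvaginPrime {q : HeightOneSpectrum (𝓞 ℚ)}
    (hKol : Kato.IsKolyvaginPrime W p n ((primesEquiv q : Nat.Primes) : ℕ))
    {Fr : absoluteGaloisGroup ℚ} (hFr : IsArithFrobAtPlace ℚ q Fr) :
    ((W.torsionGaloisModule ((p ^ n : ℕ) : ℤ)).comparisonP (p ^ n) Fr).eval 1 = 0 := by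
  rw [comparisonP_torsion_eq_sq_of_isKolyvaginPrime W p n hKol hFr, eval_pow, eval_sub, eval_X, eval_C,
    sub_self, zero_pow two_ne_zero]

/-- **`Q(x) = x − 1` on `E[p^n]` at a Kolyvagin prime of level `n`.** [cite: Kim2022StructureSelmer, §2.3.2] -/
theorem comparisonQ_torsion_eq_of_isKolyvaginPrime {q : HeightOneSpectrum (𝓞 ℚ)}
    (hKol : Kato.IsKolyvaginPrime W p n ((primesEquiv q : Nat.Primes) : ℕ))
    {Fr : absoluteGaloisGroup ℚ} (hFr : IsArithFrobAtPlace ℚ q Fr) :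
    (W.torsionGaloisModule ((p ^ n : ℕ) : ℤ)).comparisonQ (p ^ n) Fr = X - C 1 := by
  rw [DiscreteGaloisModule.comparisonQ, comparisonP_torsion_eq_sq_of_isKolyvaginPrime W p n hKol hFr, sq,
    Polynomial.mul_divByMonic_cancel_left _ (monic_X_sub_C 1)]

/-- **`Q(Fr⁻¹) x = Fr⁻¹ x − x` on `E[p^n]` at a Kolyvagin prime of level `n`**: Rubin's comparison
operator is `Fr⁻¹ − 1` there, so the finite–singular relation reads `Φ(τ) = Fr⁻¹Φ_r(Fr) − Φ_r(Fr)`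
and Mazur–Rubin's unitriangular modification (THEOREM D) is the identity on these primes (Kim §2.3.2).
[cite: Kim2022StructureSelmer, §2.3.2] [cite: Rubin2011, Def. 1.9.6 (p. 14)] -/
theorem comparisonOp_torsion_apply_of_isKolyvaginPrime {q : HeightOneSpectrum (𝓞 ℚ)}
    (hKol : Kato.IsKolyvaginPrime W p n ((primesEquiv q : Nat.Primes) : ℕ))
    {Fr : absoluteGaloisGroup ℚ} (hFr : IsArithFrobAtPlace ℚ q Fr) (x : geomTorsion W ((p ^ n : ℕ) : ℤ)) :
    (W.torsionGaloisModule ((p ^ n : ℕ) : ℤ)).comparisonOp (p ^ n) Fr x = Fr⁻¹ • x - x := by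
  rw [comparisonOp_def, comparisonQ_torsion_eq_of_isKolyvaginPrime W p n hKol hFr, _root_.map_sub, aeval_X,
    aeval_C, _root_.map_one, LinearMap.sub_apply, Module.End.one_apply, zmodEnd_apply,
    torsionGaloisModule_apply_apply]

/-- **`𝐏⟦Fr_q⟧ mod p^n = P(x) = det(1 − Fr_q x | E[p^n])`** at a Kolyvagin prime `q` of level `n`:
THEOREM C's `P(Fr⁻¹ | T_pE*; X) = 1 − q⁻¹a_q X + q⁻¹X²` (K1 `Rat.rubinEulerFactor_galoisRepTate`)
reduces to Rubin's comparison polynomial on `E[p^n]` because `q ≡ 1 (mod p^n)`. [folklore] -/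
theorem map_rubinEulerFactor_eq_comparisonP_of_isKolyvaginPrime
    [Module.Free ℤ_[p] (W.tateModule p)] [Module.Finite ℤ_[p] (W.tateModule p)]
    {q : HeightOneSpectrum (𝓞 ℚ)} (hKol : Kato.IsKolyvaginPrime W p n ((primesEquiv q : Nat.Primes) : ℕ))
    {Fr : absoluteGaloisGroup ℚ} (hFr : IsArithFrobAtPlace ℚ q Fr) :
    (𝐏⟦Fr⟧).map (PadicInt.toZModPow n) = (W.torsionGaloisModule ((p ^ n : ℕ) : ℤ)).comparisonP (p ^ n) Fr := by
  have hgood := Rat.hasGoodReductionAt_of_isKolyvaginPrime W hKol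
  obtain ⟨u, hu, hP⟩ := Rat.rubinEulerFactor_galoisRepTate W p hKol.ne hgood hFr
  have hfu : PadicInt.toZModPow n (u : ℤ_[p]) = 1 := by
    rw [hu, map_natCast]; exact natCast_eq_one_of_isKolyvaginPrime W p n hKol
  have hfui : PadicInt.toZModPow n ((u⁻¹ : ℤ_[p]ˣ) : ℤ_[p]) = 1 := by
    have h := congrArg (PadicInt.toZModPow n) (u.inv_mul)
    rwa [map_mul, hfu, mul_one, map_one] at h
  rw [hP, comparisonP_torsion_frobenius W p n hKol.ne hgood hFr,
    natCast_eq_one_of_isKolyvaginPrime W p n hKol, Polynomial.map_add, Polynomial.map_sub,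
    Polynomial.map_one, Polynomial.map_mul, Polynomial.map_mul, Polynomial.map_pow, map_X, map_C, map_C,
    map_mul, hfui, one_mul, map_intCast]

/-- **`Q̃ mod p^n = Q(x) = P(x)/(x − 1)`** at a Kolyvagin prime `q` of level `n`, for ANY `Q̃ ∈ ℤ_p[X]`
with `(X − 1)·Q̃ = 𝐏⟦Fr_q⟧ − 𝐏⟦Fr_q⟧(1)` (THEOREM C's binder `hQ`): reduce mod `p^n`, use `P(1) = 0` and
the uniqueness of division by the monic `X − 1`. [folklore] -/
theorem map_eq_comparisonQ_of_isKolyvaginPrime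
    [Module.Free ℤ_[p] (W.tateModule p)] [Module.Finite ℤ_[p] (W.tateModule p)]
    {q : HeightOneSpectrum (𝓞 ℚ)} (hKol : Kato.IsKolyvaginPrime W p n ((primesEquiv q : Nat.Primes) : ℕ))
    {Fr : absoluteGaloisGroup ℚ} (hFr : IsArithFrobAtPlace ℚ q Fr)
    (Q : ℤ_[p][X]) (hQ : (X - C 1) * Q = 𝐏⟦Fr⟧ - C ((𝐏⟦Fr⟧).eval 1)) :
    Q.map (PadicInt.toZModPow n) = (W.torsionGaloisModule ((p ^ n : ℕ) : ℤ)).comparisonQ (p ^ n) Fr := by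
  have h := congrArg (Polynomial.map (PadicInt.toZModPow n)) hQ
  rw [Polynomial.map_mul, Polynomial.map_sub, map_X, map_C, map_one, Polynomial.map_sub, map_C,
    ← Polynomial.eval_one_map, map_rubinEulerFactor_eq_comparisonP_of_isKolyvaginPrime W p n hKol hFr,
    eval_one_comparisonP_torsion_eq_zero_of_isKolyvaginPrime W p n hKol hFr, _root_.map_zero, sub_zero] at h
  rw [DiscreteGaloisModule.comparisonQ, ← h, Polynomial.mul_divByMonic_cancel_left _ (monic_X_sub_C 1)]

end Kolyvagin

section Operator

open WeierstrassCurve Rat.HeightOneSpectrum Summit.BirchSwinnertonDyer.Rank1Residual.GaloisImage.CyclotomicLevel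

/-- **§5, C5b (i): `Q̃(Fr_q⁻¹) = Q(Fr_q⁻¹)` on `E[p^n]` at a Kolyvagin prime `q` of level `n`.**  For
ANY `Q̃ ∈ ℤ_p[X]` with `(X − 1)Q̃ = 𝐏⟦Fr⟧ − 𝐏⟦Fr⟧(1)` (THEOREM C's binder `hQ`) and ANY `ℤ_p`-module `M′`
with an endomorphism `T`, mapped additively into `E[m]` (`m = p^n`, any spelling, any `ℤ/p^n`-structure
free of finite rank) by `g` so that scalars act through residues mod `p^n` (`hg`) and `T` acts as
`Fr⁻¹` (`hT`): `g` carries THEOREM C's operator `aeval T Q̃`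
(`Derivative.Rat.apply_sigma_eq_aeval_apply_of_eulerSystem`, `T = ρ_{T′}(Fr⁻¹)`) to Rubin's
`comparisonOp (p^n) Fr = Q(Fr⁻¹)` of `W.torsionGaloisModule m` — the right-hand side of the hypothesis
`hΦ` of p11's `FS.singularLocalization_eq_fsLocalization_of_forall_apply_eq` (`fs_rel`).  Case of
record: `M′ = E[p^n]_{ℤ_p}` = `TorsionCoeff.torsionRepPadicInt W p n` (GZ-2: `hg` is
`TorsionCoeff.smul_def`, `hT` is `rfl`, `g` the inclusion `E[p^n] ≤ E[m]`).  No instance declared here.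
Rubin, PCMI 18 (2011), Def. 1.9.6; Rubin, *Euler Systems* (2000), Thm. 4.5.4. [folklore] -/
theorem map_aeval_eq_comparisonOp_of_isKolyvaginPrime
    (W : WeierstrassCurve ℚ) [W.IsElliptic] [W.IsGloballyMinimal] (p : ℕ) [Fact p.Prime] (n : ℕ)
    [Module.Free ℤ_[p] (W.tateModule p)] [Module.Finite ℤ_[p] (W.tateModule p)]
    {m : ℤ} (hm : m = ((p ^ n : ℕ) : ℤ))
    [Module (ZMod (p ^ n)) (geomTorsion W m)] [Module.Free (ZMod (p ^ n)) (geomTorsion W m)]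
    [Module.Finite (ZMod (p ^ n)) (geomTorsion W m)]
    {q : HeightOneSpectrum (𝓞 ℚ)} (hKol : Kato.IsKolyvaginPrime W p n ((primesEquiv q : Nat.Primes) : ℕ))
    {Fr : absoluteGaloisGroup ℚ} (hFr : IsArithFrobAtPlace ℚ q Fr)
    (Q : ℤ_[p][X])
    (hQ : (X - C 1) * Q =
      rubinEulerFactor (WeierstrassCurve.galoisRepTate W p) (cyclotomicCharacterToUnits ℚ p ℤ_[p]) Fr -
        C ((rubinEulerFactor (WeierstrassCurve.galoisRepTate W p)
          (cyclotomicCharacterToUnits ℚ p ℤ_[p]) Fr).eval 1))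
    {M' : Type*} [AddCommGroup M'] [Module ℤ_[p] M'] (T : Module.End ℤ_[p] M')
    (g : M' →+ geomTorsion W m)
    (hg : ∀ (r : ℤ_[p]) (z : M'),
      ((g (r • z) : geomTorsion W m) : geomPoints W) = (PadicInt.toZModPow n r).val • (g z : geomPoints W))
    (hT : ∀ z : M', ((g (T z) : geomTorsion W m) : geomPoints W) = Fr⁻¹ • (g z : geomPoints W))
    (y : M') :
    g (aeval T Q y) = (W.torsionGaloisModule m).comparisonOp (p ^ n) Fr (g y) := by
  subst hm
  haveI : NeZero (p ^ n) := ⟨pow_ne_zero _ (Fact.out : p.Prime).ne_zero⟩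
  rw [comparisonOp_def, ← map_eq_comparisonQ_of_isKolyvaginPrime W p n hKol hFr Q hQ]
  refine KSDevissage.apply_aeval_eq_aeval_map (PadicInt.toZModPow n) g (fun r z => ?_) _ _
    (fun z => ?_) Q y
  · apply Subtype.ext
    rw [hg, zmod_smul_eq_val_smul, AddSubmonoidClass.coe_nsmul]
  · apply Subtype.ext
    rw [hT, zmodEnd_apply, torsionGaloisModule_apply_apply, AddSubgroup.torsionBy.coe_smul]

end Operator

end Summit.BirchSwinnertonDyer.Rank1Residual.GaloisImage.TorsionComparison

end
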